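import Summits.CriticalPhenomena.PercolationContinuityZ3.Theorems.PercNearOneGluingNoHeavyQuantSliceHeavy
import HarnessLib

/-!
# QUANT lane R8, T-DEC: the WINDOW PAIR WITH TRANSFER (census-2 g55's `LawDec.SliceLawSW`, MID case `T + ag ≤ 2h`, `h′ = h`)
# — part 1: the seven-component MIXTURE WITNESS as a kernel statement (weights as hypotheses)

builds on p205010 (kernel theorem, internal audit signed; external expert review pending)

Support file (`--supports stmt-CriticalPhenomena-4575`), QUANT lane seat prim-quant-census-1 (gen 20), rung R8 of
`run/shared/lean/prim/quant/LADDER.md`.  Theorems only, standard axioms, no sorries.  Memo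
`run/shared/lean/prim/quant/prim-quant-census-1/SLICELAWSW-G20.md` (cell decomposition, exact censuses, the inequalities).

THE SETTING (census-2 g55, `…QuantSliceSingleLayerLaws`: conjecture `LawDec.SliceLawSW`, the last open input of
`SliceSingleLayer ⟹ SliceClosedAll / SliceClosedWindowT`).  A light credit pair `{l, h; γ}` at its minimal gate (credit exactly `T`)
whose absorber `h` is a WINDOW atom (`h ≤ j′ < h + a`) is sliced by a blob `(a, g)`; the transferred law moves `s = t(1−g)` of the
row-1 giant mass `γg` (position `h + a`) down to the row-0 copy of a window position `h′ ≥ h`.  Census-1 g20's exact cell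
decomposition (SLICELAWSW-G20 §2): the heavy case is `slice_heavyPair_decAtT` (`t = 0`), the band-like case `2h < T + ag` is the typer's
`BandTwoBlobDEC` (`t = 0`), the case `h′ > h` follows from `h′ = h` by moving absorber mass upward, and the MID case `T + ag ≤ 2h`,
`h′ = h` — the law `A·δ_l + B·δ_{l+a} + H·δ_h + G·δ_{h+a}` — is decomposed into at most SEVEN valid two-point components:
the credit pairs `(l+a, h)` (deep lows), `(l, l+a)` (the vertical pair of a shallow low), `(l, h)`, the giant pair `(l, h+a)` at gate `x`,
and point masses at `l+a`, `h`, `h+a`.  This file states that witness once, with the component weights and gates as real parameters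
and the four atom-balance identities + validity facts as hypotheses (`windowPair_decAtT_of_weights`); parts 2–4 compute the weights
cell by cell (D-A/D-B/D-C deep, S-A/S-B/S-C shallow) and discharge the sign conditions.

* `LawDec.decAtT_of_seven` — seven weighted components valid at a common explicit target assemble to a `DECAtT` datum
  (`decAtT_finite_mixture` + `decAtT_single`; the `DECAtT` analogue of census-2 g51's `BlobDec2.decAt_of_six`).
* **`LawDec.windowPair_decAtT_of_weights`** — the MID witness.

[this work]; DEC rules ARCH-TREES-G49 §2.2 / DEC-TAMP-G50 §3.1 (this lane).  Nothing here is cited as a published result.  The gluing rows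
served [cite: KozmaNitzan2024, Conjecture 3 (p. 15)]; product measure [cite: Grimmett1999, §1.3 p. 10].
-/

noncomputable section

namespace Summit.CriticalPhenomena.PercolationContinuityZ3.Theorems

namespace Quant

open Finset

/-- the two-point law `{lo, hi; g}` (as in `…QuantLawDEC`) -/
local notation3 "TP[" lo ", " hi ", " g ", " h "]" =>
  (g : ℝ) * (if (h : ℕ) = (hi : ℕ) then (1 : ℝ) else 0) + (1 - (g : ℝ)) * (if (h : ℕ) = (lo : ℕ) then (1 : ℝ) else 0)

namespace LawDec

/-! ### Seven components at a common explicit target -/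

/-- **seven weighted two-point components valid at `(x, T, j′)` assemble to `DECAtT x T j′ M μ`** when the weights are
nonnegative with total `1`, the gates lie in `[0,1]`, `lo ≤ hi ≤ M`, the mixture is `μ` pointwise, and every CHARGED component is
`ValidAt`.  Unused slots carry weight `0`. [this work] -/
theorem decAtT_of_seven (x T : ℝ) (j' M : ℕ) (μ : ℕ → ℝ)
    (w₁ w₂ w₃ w₄ w₅ w₆ w₇ g₁ g₂ g₃ g₄ g₅ g₆ g₇ : ℝ) (l₁ l₂ l₃ l₄ l₅ l₆ l₇ k₁ k₂ k₃ k₄ k₅ k₆ k₇ : ℕ)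
    (hw : 0 ≤ w₁ ∧ 0 ≤ w₂ ∧ 0 ≤ w₃ ∧ 0 ≤ w₄ ∧ 0 ≤ w₅ ∧ 0 ≤ w₆ ∧ 0 ≤ w₇)
    (hsum : w₁ + w₂ + w₃ + w₄ + w₅ + w₆ + w₇ = 1)
    (hmix : ∀ h : ℕ, μ h = w₁ * TP[l₁, k₁, g₁, h] + w₂ * TP[l₂, k₂, g₂, h] + w₃ * TP[l₃, k₃, g₃, h]
        + w₄ * TP[l₄, k₄, g₄, h] + w₅ * TP[l₅, k₅, g₅, h] + w₆ * TP[l₆, k₆, g₆, h] + w₇ * TP[l₇, k₇, g₇, h])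
    (hv₁ : 0 < w₁ → (0 ≤ g₁ ∧ g₁ ≤ 1) ∧ l₁ ≤ k₁ ∧ k₁ ≤ M ∧ ValidAt x T j' l₁ k₁ g₁)
    (hv₂ : 0 < w₂ → (0 ≤ g₂ ∧ g₂ ≤ 1) ∧ l₂ ≤ k₂ ∧ k₂ ≤ M ∧ ValidAt x T j' l₂ k₂ g₂)
    (hv₃ : 0 < w₃ → (0 ≤ g₃ ∧ g₃ ≤ 1) ∧ l₃ ≤ k₃ ∧ k₃ ≤ M ∧ ValidAt x T j' l₃ k₃ g₃)
    (hv₄ : 0 < w₄ → (0 ≤ g₄ ∧ g₄ ≤ 1) ∧ l₄ ≤ k₄ ∧ k₄ ≤ M ∧ ValidAt x T j' l₄ k₄ g₄)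
    (hv₅ : 0 < w₅ → (0 ≤ g₅ ∧ g₅ ≤ 1) ∧ l₅ ≤ k₅ ∧ k₅ ≤ M ∧ ValidAt x T j' l₅ k₅ g₅)
    (hv₆ : 0 < w₆ → (0 ≤ g₆ ∧ g₆ ≤ 1) ∧ l₆ ≤ k₆ ∧ k₆ ≤ M ∧ ValidAt x T j' l₆ k₆ g₆)
    (hv₇ : 0 < w₇ → (0 ≤ g₇ ∧ g₇ ≤ 1) ∧ l₇ ≤ k₇ ∧ k₇ ≤ M ∧ ValidAt x T j' l₇ k₇ g₇) :
    DECAtT x T j' M μ := by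
  obtain ⟨hw₁, hw₂, hw₃, hw₄, hw₅, hw₆, hw₇⟩ := hw
  refine decAtT_finite_mixture x T j' M μ ![w₁, w₂, w₃, w₄, w₅, w₆, w₇]
    (fun i h => TP[![l₁, l₂, l₃, l₄, l₅, l₆, l₇] i, ![k₁, k₂, k₃, k₄, k₅, k₆, k₇] i, ![g₁, g₂, g₃, g₄, g₅, g₆, g₇] i, h])
    ?_ ?_ ?_ ?_
  · intro i; fin_cases i <;> assumption
  · rw [Fin.sum_univ_seven]; exact hsum
  · intro h; rw [Fin.sum_univ_seven]; exact hmix h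
  · intro i hi
    fin_cases i
    · obtain ⟨hg, hlk, hk, hval⟩ := hv₁ hi; exact decAtT_single x T j' M l₁ k₁ g₁ hg hlk hk hval
    · obtain ⟨hg, hlk, hk, hval⟩ := hv₂ hi; exact decAtT_single x T j' M l₂ k₂ g₂ hg hlk hk hval
    · obtain ⟨hg, hlk, hk, hval⟩ := hv₃ hi; exact decAtT_single x T j' M l₃ k₃ g₃ hg hlk hk hval
    · obtain ⟨hg, hlk, hk, hval⟩ := hv₄ hi; exact decAtT_single x T j' M l₄ k₄ g₄ hg hlk hk hval
    · obtain ⟨hg, hlk, hk, hval⟩ := hv₅ hi; exact decAtT_single x T j' M l₅ k₅ g₅ hg hlk hk hval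
    · obtain ⟨hg, hlk, hk, hval⟩ := hv₆ hi; exact decAtT_single x T j' M l₆ k₆ g₆ hg hlk hk hval
    · obtain ⟨hg, hlk, hk, hval⟩ := hv₇ hi; exact decAtT_single x T j' M l₇ k₇ g₇ hg hlk hk hval

/-! ### The MID witness of the window pair with transfer -/

/-- **THE SEVEN-COMPONENT WITNESS OF THE WINDOW PAIR (MID case, `h′ = h`).**  Positions `l < l + a ≤ j′`, `l < h ≤ j′ < h + a ≤ M′`
(`h` a window atom, its shifted copy a giant), floor `0 ≤ x ≤ 1`, explicit target `T′` with `T′ ≤ 2h` (the row-0 copy of `h` is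
self-sufficient).  The law `μ = A·δ_l + B·δ_{l+a} + H·δ_h + G·δ_{h+a}` (masses `≥ 0`... only their balance is used) is
`DECAtT x T′ j′ M′` as soon as there are
* weights `λ₁, λᵥ, λ₀, λ_G, π_a, π_h, π_G ≥ 0` and gates `γ₁, γᵥ, γ₀ ∈ [0,1]` with the ATOM BALANCE
  `λᵥ(1−γᵥ) + λ₀(1−γ₀) + λ_G(1−x) = A`, `λ₁(1−γ₁) + λᵥγᵥ + π_a = B`, `λ₁γ₁ + λ₀γ₀ + π_h = H`, `λ_G·x + π_G = G`, `A + B + H + G = 1`;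
* validity of the charged components: `λ₁ > 0 →` the pair `(l+a, h)` is a credit pair (`l + a < h`, rule (N) credit `≥ T′` at `γ₁`);
  `λᵥ > 0 →` the vertical pair `(l, l+a)` has credit `≥ T′` at `γᵥ`; `λ₀ > 0 →` the pair `(l, h)` has credit `≥ T′` at `γ₀`;
  `π_a > 0 → T′ ≤ 2(l+a)` (the point `l + a` is self-sufficient).  The giant pair `(l, h+a)` at gate `x`, the points `h` (`T′ ≤ 2h`)
  and `h + a` (`> j′`) are always valid.
Components: `λ₁·{l+a, h; γ₁} + λᵥ·{l, l+a; γᵥ} + λ₀·{l, h; γ₀} + λ_G·{l, h+a; x} + π_a·δ_{l+a} + π_h·δ_h + π_G·δ_{h+a}`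
(`decAtT_of_seven`).  Positions may coincide (`l + a = h` is allowed): the balance is per named position. [this work] -/
theorem windowPair_decAtT_of_weights (x T' : ℝ) (j' M' l a h : ℕ) (A B H G : ℝ)
    (γ₁ γv γ₀ lam₁ lamv lam₀ lamG πa πh πG : ℝ)
    (hx0 : 0 ≤ x) (hx1 : x ≤ 1) (ha : 1 ≤ a) (hlh : l < h) (hlaj : l + a ≤ j') (hhj : h ≤ j') (hjha : j' + 1 ≤ h + a)
    (hM : h + a ≤ M') (hTh : T' ≤ 2 * (h : ℝ))
    (hγ₁ : 0 ≤ γ₁ ∧ γ₁ ≤ 1) (hγv : 0 ≤ γv ∧ γv ≤ 1) (hγ₀ : 0 ≤ γ₀ ∧ γ₀ ≤ 1)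
    (hlam₁ : 0 ≤ lam₁) (hlamv : 0 ≤ lamv) (hlam₀ : 0 ≤ lam₀) (hlamG : 0 ≤ lamG) (hπa : 0 ≤ πa) (hπh : 0 ≤ πh) (hπG : 0 ≤ πG)
    (hbalA : lamv * (1 - γv) + lam₀ * (1 - γ₀) + lamG * (1 - x) = A)
    (hbalB : lam₁ * (1 - γ₁) + lamv * γv + πa = B)
    (hbalH : lam₁ * γ₁ + lam₀ * γ₀ + πh = H)
    (hbalG : lamG * x + πG = G)
    (htot : A + B + H + G = 1)
    (hv₁ : 0 < lam₁ → l + a < h ∧ T' ≤ 2 * ((l + a : ℕ) : ℝ) + ((h : ℝ) - ((l + a : ℕ) : ℝ)) * (if x ≤ γ₁ then γ₁ else (γ₁ - x ^ 2) / (1 - x)))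
    (hvv : 0 < lamv → T' ≤ 2 * (l : ℝ) + (((l + a : ℕ) : ℝ) - (l : ℝ)) * (if x ≤ γv then γv else (γv - x ^ 2) / (1 - x)))
    (hv₀ : 0 < lam₀ → T' ≤ 2 * (l : ℝ) + ((h : ℝ) - (l : ℝ)) * (if x ≤ γ₀ then γ₀ else (γ₀ - x ^ 2) / (1 - x)))
    (hva : 0 < πa → T' ≤ 2 * ((l + a : ℕ) : ℝ)) :
    DECAtT x T' j' M' (fun k => A * (if k = l then (1 : ℝ) else 0) + B * (if k = l + a then (1 : ℝ) else 0)
      + H * (if k = h then (1 : ℝ) else 0) + G * (if k = h + a then (1 : ℝ) else 0)) := by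
  refine decAtT_of_seven x T' j' M' _ lam₁ lamv lam₀ lamG πa πh πG γ₁ γv γ₀ x 0 0 0
    (l + a) l l l (l + a) h (h + a) h (l + a) h (h + a) (l + a) h (h + a)
    ⟨hlam₁, hlamv, hlam₀, hlamG, hπa, hπh, hπG⟩ ?_ ?_ ?_ ?_ ?_ ?_ ?_ ?_ ?_
  · -- total weight: sum the four balances
    linear_combination hbalB + hbalA + hbalH + hbalG + htot
  · -- the mixture identity, per named position
    intro k
    linear_combination (-(if k = l then (1 : ℝ) else 0)) * hbalA - (if k = l + a then (1 : ℝ) else 0) * hbalB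
      - (if k = h then (1 : ℝ) else 0) * hbalH - (if k = h + a then (1 : ℝ) else 0) * hbalG
  · intro h₁
    obtain ⟨hlt, hcr⟩ := hv₁ h₁
    exact ⟨hγ₁, hlt.le, by omega, Or.inr (Or.inr ⟨hlt, hhj, hcr⟩)⟩
  · intro h₂
    exact ⟨hγv, by omega, by omega, Or.inr (Or.inr ⟨by omega, hlaj, hvv h₂⟩)⟩
  · intro h₃
    exact ⟨hγ₀, hlh.le, by omega, Or.inr (Or.inr ⟨hlh, hhj, hv₀ h₃⟩)⟩
  · intro _
    exact ⟨⟨hx0, hx1⟩, by omega, hM, Or.inr (Or.inl ⟨by omega, hjha, le_rfl⟩)⟩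
  · intro h₅
    exact ⟨⟨le_rfl, zero_le_one⟩, le_rfl, by omega, Or.inl ⟨rfl, Or.inl (hva h₅)⟩⟩
  · intro _
    exact ⟨⟨le_rfl, zero_le_one⟩, le_rfl, by omega, Or.inl ⟨rfl, Or.inl hTh⟩⟩
  · intro _
    exact ⟨⟨le_rfl, zero_le_one⟩, le_rfl, hM, Or.inl ⟨rfl, Or.inr hjha⟩⟩

end LawDec

end Quant

end Summit.CriticalPhenomena.PercolationContinuityZ3.Theorems
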